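import Mathlib
import Literature.Analysis.FluidPDE.Tao2016AveragedNS.ShiftSetCascadeFlows
import Literature.Analysis.FluidPDE.Tao2016AveragedNS.ShiftSetCascadeFlux
import Literature.Analysis.ODE.GlobalExistence
import Summits.NavierStokesRegularity.NavierStokesRegularity.Theorems.TaoLadderRungTwoFlatHomogeneousL2Field
import Summits.NavierStokesRegularity.NavierStokesRegularity.Theorems.TaoLadderRungTwoFlatMirrorTableDefs
import Summits.NavierStokesRegularity.NavierStokesRegularity.Theorems.TaoLadderRungTwoFlatPulseDefs
import Summits.NavierStokesRegularity.NavierStokesRegularity.Theorems.TaoLadderRungTwoFlatCaptureDefs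
import HarnessLib

/-!
# GLOBAL EXISTENCE of finite-energy solutions of the homogeneous `𝕊`-lattice, and of DATUM SOLUTIONS of the
  mirror lattice (`MirrorPulse.exists_isDatumSol` — referee carry A-79 of cell harvest/h2-tao-ladder)
  (helper for item stmt-NavierStokesRegularity-22987 `FlatGapCertificatesV2`, crux K_A♭ of route
  TaoLadderRungTwoFlat; p1 g20)

The companion module `…TaoLadderRungTwoFlatHomogeneousL2Field` makes the scale-ratio-`1` lattice `Ẋ = Q(X)` an ODE
`U̇ = l2Field U` on the Hilbert space `ℓ²(ℤ; ℝ^m)`, Lipschitz on balls and ENERGY-NEUTRAL (`⟪Q(U), U⟫ = 0`).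
Hence the energy `‖U(t)‖²` is conserved along every solution (`norm_sq_eq_of_l2Solution`), which is the a priori
bound that the tree's continuation principle (`Literature.Analysis.ODE.exists_solution_Ici_of_apriori_bound`,
Teschl 2012 Cor. 2.16) turns into a solution on `[0, ∞)`; time reversal (`Q(−U) = Q(U)`) gives `(−∞, 0]`, and
the two branches glue at `0`:

* `exists_l2Solution_forward`, `exists_l2Solution` — for every finite-energy datum a GLOBAL solution
  `W : ℝ → ℓ²` with `HasDerivAt W (Q(W t)) t` at every `t` and `‖W t‖ = ‖W 0‖` for all `t`;
* `exists_globalSol_of_l2` — its coordinates `X_{i,n}(t)` solve `Ẋ_{i,n} = quadTermOn 𝕊 0 α X i n` at every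
  time, are bounded by `‖U₀‖` at every site and time, and carry the energy identity
  `∑ₙ ∑ᵢ X_{i,n}(t)² = ‖U₀‖²` (any `m`, any nearest-neighbour slot-closed `𝕊`, any table cancelling on `𝕊`);
* `MirrorPulse.exists_isDatumSol` — **for every `ε` and every one-shell datum `X₀` the mirror lattice `T♭(ε)`
  has a datum solution** (`IsDatumSol ε X₀ X`), uniformly bounded (`IsBddFam X`, bound `‖X₀‖`), with conserved
  energy `∑ₙ ∑ᵢ X_{i,n}(t)² = ∑ᵢ X₀ᵢ²`. With `…FlowContinuity.isGlobalSol_unique` it is unique among bounded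
  solutions, so (S3) `CapturedBy ε Φ X₀` and the bundle `MirrorWaveAt ε X₀` (`…CaptureDefs`) quantify over a
  NON-EMPTY class (referee c81 A-79).

HONEST FRAMING: standard ODE theory (Picard–Lindelöf + continuation from a conserved energy) for MODEL lattices;
no pulse is constructed, nothing is certified, nothing here is a statement about the Navier–Stokes equations.
-/

noncomputable section

-- the sub-problem namespace repeats the summit name by design (D-0017)
set_option linter.dupNamespace false

namespace Summit.NavierStokesRegularity.NavierStokesRegularity.Theorems

open Set Filter Metric Literature.Analysis.FluidPDE Literature.Analysis.FluidPDE.TaoCascade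
open scoped Topology NNReal ENNReal RealInnerProductSpace

namespace QuadPolar

variable {m : ℕ}

/-! ### Energy conservation along solutions -/

/-- **Energy conservation**: along every solution of `U̇ = Q(U)` on `[a, b]` in `ℓ²(ℤ; ℝ^m)` (nearest-neighbour,
slot-closed `𝕊`; table cancelling on `𝕊`), `‖U(t)‖² = ‖U(a)‖²`.
[cite: Tao2016AveragedNS, §4 (4.3) and proof of Lemma 4.1 (v); folklore] -/
theorem norm_sq_eq_of_l2Solution {𝕊 : Finset (ℤ × ℤ × ℤ)} (h𝕊 : IsNearestNeighbourSet 𝕊)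
    (h𝕊' : IsSlotClosed 𝕊) {α : Fin m → Fin m → Fin m → ℤ × ℤ × ℤ → ℝ} (hα : IsCancellingCoeffOn 𝕊 α)
    {a b : ℝ} {W : ℝ → lp (fun _ : ℤ => EuclideanSpace ℝ (Fin m)) 2}
    (hW : ∀ t ∈ Icc a b, HasDerivWithinAt W (l2Field h𝕊 α (W t)) (Icc a b) t) :
    ∀ t ∈ Icc a b, ‖W t‖ ^ 2 = ‖W a‖ ^ 2 := by
  have hcont : ContinuousOn (fun t => ‖W t‖ ^ 2) (Icc a b) :=
    fun t ht => (hW t ht).norm_sq.continuousWithinAt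
  have hder : ∀ x ∈ Ico a b, HasDerivWithinAt (fun t => ‖W t‖ ^ 2) 0 (Ici x) x := by
    intro x hx
    have h := (hW x ⟨hx.1, hx.2.le⟩).norm_sq
    have h0 : ⟪W x, l2Field h𝕊 α (W x)⟫ = 0 := by
      rw [real_inner_comm]; exact inner_l2Field_self h𝕊 h𝕊' hα (W x)
    rw [h0, mul_zero] at h
    exact h.mono_of_mem_nhdsWithin
      (Filter.mem_of_superset (inter_mem_nhdsWithin (Ici x) (Iio_mem_nhds hx.2))
        fun y hy => ⟨hx.1.trans hy.1, hy.2.le⟩)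
  exact constant_of_has_deriv_right_zero hcont hder

/-- From `‖U‖² = ‖V‖²` to `‖U‖ = ‖V‖`. [folklore] -/
theorem norm_eq_of_sq_eq {E : Type*} [NormedAddCommGroup E] {U V : E} (h : ‖U‖ ^ 2 = ‖V‖ ^ 2) :
    ‖U‖ = ‖V‖ := by
  rw [← Real.sqrt_sq (norm_nonneg U), h, Real.sqrt_sq (norm_nonneg V)]

/-! ### Global existence in `ℓ²` -/

/-- **Forward global solution with conserved energy**: from every finite-energy datum `U₀` the homogeneous
`𝕊`-lattice has a solution `W` on `[0, ∞)` in `ℓ²(ℤ; ℝ^m)` (`HasDerivAt` for `t > 0`, right derivative at `0`)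
with `‖W t‖ = ‖U₀‖` — energy conservation is the a priori bound of the continuation principle.
[cite: Teschl2012, Cor. 2.16; Tao2016AveragedNS, §4 Lemma 4.1 (statement shape: global solutions from data)] -/
theorem exists_l2Solution_forward {𝕊 : Finset (ℤ × ℤ × ℤ)} (h𝕊 : IsNearestNeighbourSet 𝕊)
    (h𝕊' : IsSlotClosed 𝕊) {α : Fin m → Fin m → Fin m → ℤ × ℤ × ℤ → ℝ} (hα : IsCancellingCoeffOn 𝕊 α)
    (U₀ : lp (fun _ : ℤ => EuclideanSpace ℝ (Fin m)) 2) :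
    ∃ W : ℝ → lp (fun _ : ℤ => EuclideanSpace ℝ (Fin m)) 2, W 0 = U₀ ∧
      (∀ t, 0 ≤ t → HasDerivWithinAt W (l2Field h𝕊 α (W t)) (Ici 0) t) ∧
      (∀ t, 0 < t → HasDerivAt W (l2Field h𝕊 α (W t)) t) ∧ ∀ t, 0 ≤ t → ‖W t‖ = ‖U₀‖ := by
  have hlip : ∀ T ρ : ℝ, ∃ K : ℝ≥0, ∀ t ∈ Icc 0 T, LipschitzOnWith K
      ((fun (_ : ℝ) (U : lp (fun _ : ℤ => EuclideanSpace ℝ (Fin m)) 2) => l2Field h𝕊 α U) t)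
      (closedBall 0 ρ) := by
    intro T ρ
    refine ⟨Real.toNNReal (6 * Real.sqrt m * tableAbsSum 𝕊 α * max ρ 0), fun t _ => ?_⟩
    exact (lipschitzOnWith_l2Field h𝕊 α (le_max_right ρ 0)).mono
      (closedBall_subset_closedBall (le_max_left ρ 0))
  have hcont : ∀ U : lp (fun _ : ℤ => EuclideanSpace ℝ (Fin m)) 2, ContinuousOn
      (fun t : ℝ => (fun (_ : ℝ) (U : lp (fun _ : ℤ => EuclideanSpace ℝ (Fin m)) 2) => l2Field h𝕊 α U) t U)
      (Ici 0) := fun _ => continuousOn_const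
  have hapriori : ∀ T : ℝ, 0 ≤ T → ∃ R : ℝ, ‖U₀‖ ≤ R ∧ ∀ s ∈ Icc 0 T,
      ∀ β : ℝ → lp (fun _ : ℤ => EuclideanSpace ℝ (Fin m)) 2, β 0 = U₀ →
      (∀ t ∈ Icc 0 s, HasDerivWithinAt β
        ((fun (_ : ℝ) (U : lp (fun _ : ℤ => EuclideanSpace ℝ (Fin m)) 2) => l2Field h𝕊 α U) t (β t))
        (Icc 0 s) t) → ∀ t ∈ Icc 0 s, ‖β t‖ ≤ R := by
    intro T _
    refine ⟨‖U₀‖, le_rfl, fun s _ β hβ0 hβ t ht => ?_⟩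
    have h := norm_sq_eq_of_l2Solution h𝕊 h𝕊' hα hβ t ht
    rw [hβ0] at h
    exact (norm_eq_of_sq_eq h).le
  obtain ⟨W, hW0, -, hWw, hWd⟩ := Literature.Analysis.ODE.exists_solution_Ici_of_apriori_bound
    (v := fun (_ : ℝ) (U : lp (fun _ : ℤ => EuclideanSpace ℝ (Fin m)) 2) => l2Field h𝕊 α U) (x₀ := U₀)
    hlip hcont hapriori
  refine ⟨W, hW0, hWw, hWd, fun t ht => ?_⟩
  have hsol : ∀ x ∈ Icc 0 t, HasDerivWithinAt W (l2Field h𝕊 α (W x)) (Icc 0 t) x :=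
    fun x hx => (hWw x hx.1).mono Icc_subset_Ici_self
  have h := norm_sq_eq_of_l2Solution h𝕊 h𝕊' hα hsol t ⟨ht, le_rfl⟩
  rw [hW0] at h
  exact norm_eq_of_sq_eq h

/-- **GLOBAL SOLUTION IN `ℓ²` FROM EVERY FINITE-ENERGY DATUM**, both time directions: `W 0 = U₀`,
`HasDerivAt W (Q(W t)) t` at EVERY `t ∈ ℝ`, and `‖W t‖ = ‖U₀‖` for all `t` (forward branch from `U₀`, backward
branch `t ↦ −W̃(−t)` with `W̃` the forward solution from `−U₀`, using `Q(−U) = Q(U)`; glued at `0`).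
[cite: Teschl2012, Cor. 2.16; Tao2016AveragedNS, §4 (4.8)] -/
theorem exists_l2Solution {𝕊 : Finset (ℤ × ℤ × ℤ)} (h𝕊 : IsNearestNeighbourSet 𝕊)
    (h𝕊' : IsSlotClosed 𝕊) {α : Fin m → Fin m → Fin m → ℤ × ℤ × ℤ → ℝ} (hα : IsCancellingCoeffOn 𝕊 α)
    (U₀ : lp (fun _ : ℤ => EuclideanSpace ℝ (Fin m)) 2) :
    ∃ W : ℝ → lp (fun _ : ℤ => EuclideanSpace ℝ (Fin m)) 2, W 0 = U₀ ∧
      (∀ t, HasDerivAt W (l2Field h𝕊 α (W t)) t) ∧ ∀ t, ‖W t‖ = ‖U₀‖ := by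
  obtain ⟨Uf, hUf0, hUfw, hUfd, hUfn⟩ := exists_l2Solution_forward h𝕊 h𝕊' hα U₀
  obtain ⟨Wb, hWb0, hWbw, hWbd, hWbn⟩ := exists_l2Solution_forward h𝕊 h𝕊' hα (-U₀)
  set U : ℝ → lp (fun _ : ℤ => EuclideanSpace ℝ (Fin m)) 2 :=
    fun t => if 0 ≤ t then Uf t else -Wb (-t) with hUdef
  have hUpos : ∀ t, 0 ≤ t → U t = Uf t := fun t ht => by simp only [hUdef, if_pos ht]
  have hUneg : ∀ t, t ≤ 0 → U t = -Wb (-t) := by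
    intro t ht
    rcases lt_or_eq_of_le ht with h | h
    · simp only [hUdef, if_neg (not_le.2 h)]
    · subst h; simp only [hUdef, le_refl, if_true, neg_zero, hUf0, hWb0, neg_neg]
  have hfield : ∀ t, t ≤ 0 → l2Field h𝕊 α (Wb (-t)) = l2Field h𝕊 α (U t) := by
    intro t ht
    rw [hUneg t ht, l2Field_neg]
  have hderU : ∀ t, HasDerivAt U (l2Field h𝕊 α (U t)) t := by
    intro t
    rcases lt_trichotomy t 0 with ht | ht | ht
    · have hcomp : HasDerivAt (fun s => -Wb (-s)) (l2Field h𝕊 α (Wb (-t))) t := by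
        have h := ((hWbd (-t) (by linarith)).scomp t (hasDerivAt_neg t)).neg
        have h' : HasDerivAt (-fun s => Wb (-s)) (l2Field h𝕊 α (Wb (-t))) t := by
          simpa [Function.comp_def] using h
        exact h'
      rw [hfield t ht.le] at hcomp
      have hev : U =ᶠ[𝓝 t] fun s => -Wb (-s) := by
        filter_upwards [Iio_mem_nhds ht] with s hs
        exact hUneg s hs.le
      exact hcomp.congr_of_eventuallyEq hev
    · subst ht
      have hr : HasDerivWithinAt U (l2Field h𝕊 α (U 0)) (Ici 0) 0 := by
        rw [hUpos 0 le_rfl]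
        exact (hUfw 0 le_rfl).congr_of_mem (fun s hs => hUpos s hs) self_mem_Ici
      have hl : HasDerivWithinAt U (l2Field h𝕊 α (U 0)) (Iic 0) 0 := by
        have hcomp : HasDerivWithinAt (fun s => -Wb (-s)) (l2Field h𝕊 α (Wb 0)) (Iic 0) 0 := by
          have h1 := hWbw 0 le_rfl
          rw [show (0 : ℝ) = -0 by simp] at h1
          have h2 := (h1.scomp (0 : ℝ) ((hasDerivAt_neg (0 : ℝ)).hasDerivWithinAt)
            (fun s (hs : s ∈ Iic (0 : ℝ)) => show -s ∈ Ici (-0 : ℝ) by simpa using hs)).neg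
          have h3 : HasDerivWithinAt (-fun s => Wb (-s)) (l2Field h𝕊 α (Wb 0)) (Iic 0) 0 := by
            simpa [Function.comp_def] using h2
          exact h3
        have e : l2Field h𝕊 α (Wb 0) = l2Field h𝕊 α (U 0) := by
          have := hfield 0 le_rfl; rw [neg_zero] at this; exact this
        rw [e] at hcomp
        exact hcomp.congr_of_mem (fun s hs => hUneg s hs) self_mem_Iic
      have hu := hl.union hr
      rw [Iic_union_Ici] at hu
      exact hu.hasDerivAt Filter.univ_mem
    · have hev : U =ᶠ[𝓝 t] Uf := by
        filter_upwards [Ioi_mem_nhds ht] with s hs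
        exact hUpos s hs.le
      rw [hUpos t ht.le]
      exact (hUfd t ht).congr_of_eventuallyEq hev
  refine ⟨U, by rw [hUpos 0 le_rfl, hUf0], hderU, fun t => ?_⟩
  rcases le_or_gt 0 t with ht | ht
  · rw [hUpos t ht]; exact hUfn t ht
  · rw [hUneg t ht.le, norm_neg, hWbn (-t) (by linarith), norm_neg]

/-! ### Coordinates -/

/-- Evaluation of a state at a shell is a continuous linear map `ℓ²(ℤ; ℝ^m) → ℝ^m`. [folklore] -/
def shellCLM (m : ℕ) (n : ℤ) : lp (fun _ : ℤ => EuclideanSpace ℝ (Fin m)) 2 →L[ℝ] EuclideanSpace ℝ (Fin m) :=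
  LinearMap.mkContinuous
    { toFun := fun U => U n
      map_add' := fun U V => by simp
      map_smul' := fun c U => by simp } 1
    fun U => by simpa using lp.norm_apply_le_norm (by norm_num : (2 : ℝ≥0∞) ≠ 0) U n

/-- `shellCLM m n U = U n`. [folklore] -/
theorem shellCLM_apply (n : ℤ) (U : lp (fun _ : ℤ => EuclideanSpace ℝ (Fin m)) 2) : shellCLM m n U = U n :=
  rfl

/-- The shell energy is the sum of the squared coordinates. [folklore] -/
theorem norm_sq_eq_sum_sq (x : EuclideanSpace ℝ (Fin m)) : ‖x‖ ^ 2 = ∑ i, x i ^ 2 := by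
  rw [PiLp.norm_sq_eq_of_L2]
  exact Finset.sum_congr rfl fun i _ => by rw [Real.norm_eq_abs, sq_abs]

/-- **GLOBAL EXACT SOLUTIONS OF THE HOMOGENEOUS `𝕊`-LATTICE FROM FINITE-ENERGY DATA** (coordinates): for any
`m`, any nearest-neighbour slot-closed `𝕊` and any table cancelling on `𝕊`, every `U₀ ∈ ℓ²(ℤ; ℝ^m)` launches a
family `X` with `X_{i,n}(0) = (U₀)_n^i`, solving `Ẋ_{i,n} = quadTermOn 𝕊 0 α X i n` at EVERY time (`HasDerivAt`),
bounded by `‖U₀‖` at every site and time, with the energy identity `∑ₙ ∑ᵢ X_{i,n}(t)² = ‖U₀‖²` for all `t`.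
[cite: Tao2016AveragedNS, §4 Lemma 4.1 (statement shape) and (4.3); Teschl2012, Cor. 2.16] -/
theorem exists_globalSol_of_l2 {𝕊 : Finset (ℤ × ℤ × ℤ)} (h𝕊 : IsNearestNeighbourSet 𝕊)
    (h𝕊' : IsSlotClosed 𝕊) {α : Fin m → Fin m → Fin m → ℤ × ℤ × ℤ → ℝ} (hα : IsCancellingCoeffOn 𝕊 α)
    (U₀ : lp (fun _ : ℤ => EuclideanSpace ℝ (Fin m)) 2) :
    ∃ X : Fin m → ℤ → ℝ → ℝ, (∀ i n, X i n 0 = U₀ n i) ∧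
      (∀ i n t, HasDerivAt (X i n) (quadTermOn 𝕊 0 α X i n t) t) ∧
      (∀ i n t, |X i n t| ≤ ‖U₀‖) ∧ ∀ t, HasSum (fun n => ∑ i, X i n t ^ 2) (‖U₀‖ ^ 2) := by
  obtain ⟨W, hW0, hWd, hWn⟩ := exists_l2Solution h𝕊 h𝕊' hα U₀
  refine ⟨fun i n t => W t n i, fun i n => by simp [hW0], fun i n t => ?_, fun i n t => ?_, fun t => ?_⟩
  · have h0 := (((EuclideanSpace.proj i).comp (shellCLM m n)).hasFDerivAt).comp_hasDerivAt t (hWd t)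
    have h1 : HasDerivAt (fun s => W s n i)
        ((l2Field h𝕊 α (W t) : ∀ _ : ℤ, EuclideanSpace ℝ (Fin m)) n i) t := by
      simpa [Function.comp_def, shellCLM_apply] using h0
    rw [l2Field_apply] at h1
    exact h1
  · calc |W t n i| ≤ ‖W t n‖ := abs_apply_le_norm (W t n) i
      _ ≤ ‖W t‖ := lp.norm_apply_le_norm (by norm_num) (W t) n
      _ = ‖U₀‖ := hWn t
  · have h := hasSum_norm_sq (W t)
    rw [hWn t] at h
    simpa [norm_sq_eq_sum_sq] using h

end QuadPolar

namespace MirrorPulse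

open QuadPolar

/-- The one-shell datum `X₀` at shell `0` as a finite-energy state. [folklore] -/
def datumState (X₀ : Fin 2 → ℝ) : lp (fun _ : ℤ => EuclideanSpace ℝ (Fin 2)) 2 :=
  lp.single 2 0 (WithLp.toLp 2 X₀)

/-- Coordinates of the datum state. [folklore] -/
theorem datumState_apply (X₀ : Fin 2 → ℝ) (n : ℤ) (i : Fin 2) :
    (datumState X₀ : ∀ _ : ℤ, EuclideanSpace ℝ (Fin 2)) n i = if n = 0 then X₀ i else 0 := by
  rw [datumState, lp.single_apply, Pi.single_apply]
  split_ifs with h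
  · subst h; simp
  · simp

/-- The energy of the datum state is `∑ᵢ X₀ᵢ²`. [folklore] -/
theorem norm_datumState_sq (X₀ : Fin 2 → ℝ) : ‖datumState X₀‖ ^ 2 = ∑ i, X₀ i ^ 2 := by
  have h := hasSum_norm_sq (datumState X₀)
  have h1 : HasSum (fun n : ℤ => ‖(datumState X₀ : ∀ _ : ℤ, EuclideanSpace ℝ (Fin 2)) n‖ ^ 2)
      (∑ i, X₀ i ^ 2) := by
    have hs : ∀ n : ℤ, n ≠ 0 → ‖(datumState X₀ : ∀ _ : ℤ, EuclideanSpace ℝ (Fin 2)) n‖ ^ 2 = 0 := by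
      intro n hn
      have : (datumState X₀ : ∀ _ : ℤ, EuclideanSpace ℝ (Fin 2)) n = 0 := by
        rw [datumState, lp.single_apply, Pi.single_apply, if_neg hn]
      rw [this, norm_zero]; ring
    have h0 : ‖(datumState X₀ : ∀ _ : ℤ, EuclideanSpace ℝ (Fin 2)) 0‖ ^ 2 = ∑ i, X₀ i ^ 2 := by
      rw [norm_sq_eq_sum_sq]
      exact Finset.sum_congr rfl fun i _ => by rw [datumState_apply, if_pos rfl]
    rw [← h0]
    exact hasSum_single 0 hs
  exact h.unique h1

/-- **DATUM SOLUTIONS EXIST** (referee carry A-79): for every `ε` and every one-shell datum `X₀` the homogeneous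
mirror lattice `T♭(ε)` (`Q = quadTermOn S♭ 0 (mirrorTable ε ε)`) has an exact global solution from `X₀` at shell
`0`, bounded at every site and time by `‖X₀‖ = (∑ᵢ X₀ᵢ²)^{1/2}` (so `IsDatumSol ε X₀ X` and `IsBddFam X`), with the
conserved energy `∑ₙ ∑ᵢ X_{i,n}(t)² = ∑ᵢ X₀ᵢ²`. Consequently (S3) `CapturedBy ε Φ X₀` and `MirrorWaveAt ε X₀`
(`…CaptureDefs`) are statements about a non-empty class of trajectories (unique in the bounded class by
`…FlowContinuity.isGlobalSol_unique`). [cite: Tao2016AveragedNS, §4 Lemma 4.1 (statement shape) and (4.3); Teschl2012, Cor. 2.16; route TaoLadderRungTwoFlat, λ₀ = 1 layer] -/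
theorem exists_isDatumSol (ε : ℝ) (X₀ : Fin 2 → ℝ) :
    ∃ X : Fin 2 → ℤ → ℝ → ℝ, IsDatumSol ε X₀ X ∧ IsBddFam X ∧
      (∀ (i : Fin 2) (n : ℤ) (t : ℝ), |X i n t| ≤ Real.sqrt (∑ j, X₀ j ^ 2)) ∧
      ∀ t : ℝ, HasSum (fun n : ℤ => ∑ i, X i n t ^ 2) (∑ i, X₀ i ^ 2) := by
  obtain ⟨X, hX0, hXd, hXb, hXe⟩ := exists_globalSol_of_l2 isNearestNeighbourSet_shiftSetFlat
    isSlotClosed_shiftSetFlat (isCancellingCoeffOn_mirrorTable ε ε) (datumState X₀)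
  have hnorm : ‖datumState X₀‖ = Real.sqrt (∑ j, X₀ j ^ 2) := by
    rw [← norm_datumState_sq, Real.sqrt_sq (norm_nonneg _)]
  refine ⟨X, ⟨fun i n t => hXd i n t, fun i n => ?_, fun T => ⟨‖datumState X₀‖, fun i n t _ => hXb i n t⟩⟩,
    ⟨‖datumState X₀‖, hXb⟩, fun i n t => hnorm ▸ hXb i n t, fun t => ?_⟩
  · rw [hX0, datumState_apply]
  · have h := hXe t
    rwa [norm_datumState_sq] at h

end MirrorPulse

end Summit.NavierStokesRegularity.NavierStokesRegularity.Theorems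

end
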